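import Literature.NumberTheory.Weil1964.AdelicSecondDegreeCharacter
import HarnessLib

/-!
# Fourier inversion on the Schwartz–Bruhat space of `𝔸_K^ι`

Topic `NumberTheory/Automorphic`; namespace `Literature.NumberTheory.Automorphic`. KERNEL MATHEMATICS
ONLY: no `def … : Prop` records, no `axiom`, no `sorry`; every `[cite: …]` / `[folklore]` tag is provenance
for a kernel-checked statement.

For a number field `K`, a finite index type `ι`, an additive Haar measure `ν` on `V = 𝔸_K^ι` and Tate's
character `ψ = adeleAddChar K`, the tree's adelic Fourier transform is
`Φ̂(η) = adelicPiFourier K ι ν Φ η = ∫ Φ(v) ψ(Σ_i η_i v_i) dν(v)` (`AdelicPiSchwartzBruhatFourier`). This file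
PROVES the **Fourier inversion formula on `𝒮(𝔸_K^ι) = piSchwartzBruhat K ι`** in Tate's unnormalised form:

* `adelicPiFourier_adelicPiFourier` — for `Φ ∈ 𝒮(𝔸_K^ι)` and every `x`,
  `Φ̂̂(x) = ν(D^ι)² · Φ(-x)`, `D^ι = piFundamentalDomain K ι` the Tate domain; in particular
  `Φ̂̂(x) = Φ(-x)` for the self-dual normalisation `ν(D^ι) = 1`
  (`adelicPiFourier_adelicPiFourier_of_measure_eq_one`), and `Φ ↦ Φ̂` is injective on `𝒮(𝔸_K^ι)`
  (`eq_of_adelicPiFourier_eq`).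

This is Tate's Theorem 4.1.2 (the inversion formula on the adele group for the self-dual measure
`dx = ∏ dx_𝔭`, for which `D` has measure `1`, Thm. 4.1.3 (2)) on the invariant subspace `𝒮(𝔸_K^ι)`, with the
constant for an arbitrary Haar measure read off exactly as in Tate's remark after Thm. 4.2.1 ("iteration of
the Poisson formula would yield `μ(D)² = 1`"). The proof given here is global and does not use the local
inversion formulas: for `Φ ∈ 𝒮`, `x, y ∈ V`, apply the tree's **Poisson summation formula**
`tsum_eq_inv_measure_mul_tsum_adelicPiFourier` to the Schwartz–Bruhat function
`G_y(v) = ψ(Σ_i y_i v_i) Φ(x + v)`, whose transform is `Ĝ_y(η) = Φ̂(y + η) ψ(-Σ_i (y + η)_i x_i)`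
(`adelicPiFourier_addChar_mul_comp_add`), and integrate the resulting identity
`Σ_ξ ψ(Σ_i y_i ξ_i) Φ(x + ξ) = ν(D)⁻¹ Σ_ξ g(y + ξ)`, `g(η) = Φ̂(η) ψ(-Σ_i η_i x_i)`, over `y ∈ D^ι`:
on the left only `ξ = 0` survives by **orthogonality of the characters `ψ(Σ ξ_i y_i)` of the compact
quotient `𝔸_K^ι ⧸ K^ι`** (`setIntegral_adeleAddChar_piFundamentalDomain`, from the tree's
`integral_fundamentalDomain_comp_mk`, `piQuotCharHom_injective` and `integral_addChar_eq_zero`), giving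
`ν(D) Φ(x)`; on the right the **unfolding** `∫_D Σ_ξ g(y + ξ) dν(y) = ∫_V g = Φ̂̂(-x)`
(`integral_eq_setIntegral_piFundamentalDomain_tsum`, Mathlib's `IsAddFundamentalDomain.integral_eq_tsum''`).

Supporting results, all proved: stability of `𝒮(𝔸_K^ι)` under translations
(`comp_add_left_mem_piSchwartzBruhat`), under `v ↦ -v` (`comp_neg_mem_piSchwartzBruhat`) and under the
character twists `Φ ↦ ψ(Σ_i y_i v_i) Φ` (`adeleAddChar_mul_mem_piSchwartzBruhat`; archimedean factor by
Mathlib's `SchwartzMap.smulLeftCLM` and the temperate growth of `s ↦ e^{2πis}` from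
`AdelicSecondDegreeCharacter`, finite factor locally constant by `isLocallyConstant_finiteAdeleAddChar`).

Consumers: the Weyl-element half of the rationality hypothesis of Weil's Théorème 6 in the concrete adelic
model (`Weil1964/AdelicThetaWeylElement`: the normalised Fourier transform is an invertible operator of
`𝒮(X_A)` of order `4` stabilising `Θ`); Tate's global functional equation.

Measurable structures: `[MeasurableSpace 𝔸_K] [BorelSpace 𝔸_K]` as in `AdelicPoissonSummation`; the compact
quotient `𝔸_K^ι ⧸ K^ι` is given its Borel σ-algebra internally.

## References

* J. Tate, *Fourier analysis in number fields and Hecke's zeta-functions*, in J. W. S. Cassels,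
  A. Fröhlich (eds.), *Algebraic Number Theory* (1967), Ch. XV: Thm. 4.1.2, Thm. 4.1.3 (2), Lemmas
  4.2.1–4.2.4 and the remark after Thm. 4.2.1 (PDF pp. 356–361 of the held copy) [CasselsFrohlichANT1967].
* A. Weil, *Basic Number Theory* (1967), Ch. VII §2, Thm. 2 [WeilBNT1967].
-/

noncomputable section

open MeasureTheory MeasureTheory.Measure NumberField NumberField.InfinitePlace NumberField.mixedEmbedding
  IsDedekindDomain Filter Topology
open scoped SchwartzMap NNReal ENNReal FourierTransform Classical

namespace Literature.NumberTheory.Automorphic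

-- the compact quotient carries its Borel σ-algebra, not the quotient σ-algebra (idiom of Mathlib's
-- `MeasureTheory.Measure.Haar.Quotient` and of the tree's `PoissonSummationCompactQuotient`)
attribute [-instance] Quotient.instMeasurableSpace QuotientAddGroup.measurableSpace

/-! ### Stability of `𝒮(𝔸_K^ι)` under translations, `v ↦ -v` and character twists -/

section Stability

variable {K : Type} [Field K] [NumberField K] {ι : Type}

/-- `piArch` commutes with negation. [folklore] -/
theorem piArch_neg (v : ι → AdeleRing (𝓞 K) K) : piArch K ι (-v) = -piArch K ι v := by
  funext i
  simp only [piArch_apply, Pi.neg_apply]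
  rw [show (-v i).1 = -(v i).1 from rfl, map_neg]

/-- `piFinite` commutes with negation. [folklore] -/
theorem piFinite_neg (v : ι → AdeleRing (𝓞 K) K) : piFinite K ι (-v) = -piFinite K ι v := rfl

variable [Fintype ι]

/-- Translates `v ↦ Φ(x + v)` of factorizable Schwartz–Bruhat functions are factorizable (translate each
factor). [folklore] -/
theorem IsFactorizablePiSchwartzBruhat.comp_add_left {Φ : (ι → AdeleRing (𝓞 K) K) → ℂ}
    (h : IsFactorizablePiSchwartzBruhat K ι Φ) (x : ι → AdeleRing (𝓞 K) K) :
    IsFactorizablePiSchwartzBruhat K ι fun v => Φ (x + v) := by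
  obtain ⟨Φinf, Φfin, hfin, rfl⟩ := h
  refine ⟨SchwartzMap.compSubConstCLM ℂ (-(piArch K ι x)) Φinf, fun b => Φfin (piFinite K ι x + b),
    ⟨hfin.1.comp_continuous (Homeomorph.addLeft (piFinite K ι x)).continuous,
      hfin.2.comp_homeomorph (Homeomorph.addLeft (piFinite K ι x))⟩, ?_⟩
  funext v
  simp only [SchwartzMap.compSubConstCLM_apply, piArch_add, piFinite_add, sub_neg_eq_add, add_comm]

/-- Reflections `v ↦ Φ(-v)` of factorizable Schwartz–Bruhat functions are factorizable. [folklore] -/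
theorem IsFactorizablePiSchwartzBruhat.comp_neg {Φ : (ι → AdeleRing (𝓞 K) K) → ℂ}
    (h : IsFactorizablePiSchwartzBruhat K ι Φ) :
    IsFactorizablePiSchwartzBruhat K ι fun v => Φ (-v) := by
  obtain ⟨Φinf, Φfin, hfin, rfl⟩ := h
  refine ⟨SchwartzMap.compCLMOfContinuousLinearEquiv ℂ
      (ContinuousLinearEquiv.neg ℝ : (ι → mixedSpace K) ≃L[ℝ] (ι → mixedSpace K)) Φinf,
    fun b => Φfin (-b),
    ⟨hfin.1.comp_continuous (Homeomorph.neg (ι → FiniteAdeleRing (𝓞 K) K)).continuous,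
      hfin.2.comp_homeomorph (Homeomorph.neg (ι → FiniteAdeleRing (𝓞 K) K))⟩, ?_⟩
  funext v
  simp only [SchwartzMap.compCLMOfContinuousLinearEquiv_apply, Function.comp_apply,
    ContinuousLinearEquiv.neg_apply, piArch_neg, piFinite_neg]

variable (K ι) in
/-- The archimedean factor `a ↦ exp(-2πi Σ_i Tr(a_i c_i))` of the characters `v ↦ ψ(Σ_i y_i v_i)`
(`adeleAddChar_sum_mul_piAdeleSplit`, with `c = piArch y`); private helper of
`IsFactorizablePiSchwartzBruhat.adeleAddChar_mul`. [folklore] -/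
private def archLinChar (c a : ι → mixedSpace K) : ℂ := ((𝐞 (-(piTracePairing K ι a c)) : Circle) : ℂ)

/-- Unfolding of `archLinChar`. [folklore] -/
private theorem archLinChar_apply (c a : ι → mixedSpace K) :
    archLinChar K ι c a = ((𝐞 (-(piTracePairing K ι a c)) : Circle) : ℂ) := rfl

/-- The archimedean character factor has temperate growth (a unitary character composed with a linear
form; `hasTemperateGrowth_fourierChar_coe` of `AdelicSecondDegreeCharacter`). [folklore] -/
private theorem hasTemperateGrowth_archLinChar (c : ι → mixedSpace K) :
    Function.HasTemperateGrowth (archLinChar K ι c) := by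
  have hB : Function.HasTemperateGrowth (fun a : ι → mixedSpace K => piTracePairing K ι a c) :=
    (LinearMap.toContinuousLinearMap ((piTracePairing K ι).flip c)).hasTemperateGrowth
  exact Weil1964.hasTemperateGrowth_fourierChar_coe.comp hB.neg

/-- Character twists `v ↦ ψ(Σ_i y_i v_i) Φ(v)` of factorizable Schwartz–Bruhat functions are factorizable:
the character splits (`adeleAddChar_sum_mul_piAdeleSplit`), its archimedean factor has temperate growth
and its finite factor is locally constant. [folklore] -/
theorem IsFactorizablePiSchwartzBruhat.adeleAddChar_mul {Φ : (ι → AdeleRing (𝓞 K) K) → ℂ}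
    (h : IsFactorizablePiSchwartzBruhat K ι Φ) (y : ι → AdeleRing (𝓞 K) K) :
    IsFactorizablePiSchwartzBruhat K ι fun v => (adeleAddChar K (∑ i, y i * v i) : ℂ) * Φ v := by
  obtain ⟨Φinf, Φfin, hfin, rfl⟩ := h
  refine ⟨SchwartzMap.smulLeftCLM ℂ (archLinChar K ι (piArch K ι y)) Φinf,
    fun b => (finiteAdeleAddChar K (∑ i, piFinite K ι y i * b i) : ℂ) * Φfin b, ⟨?_, ?_⟩, ?_⟩
  · have hc : Continuous fun b : ι → FiniteAdeleRing (𝓞 K) K => ∑ i, piFinite K ι y i * b i :=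
      continuous_finsetSum _ fun i _ => continuous_const.mul (continuous_apply i)
    exact ((Weil1964.isLocallyConstant_finiteAdeleAddChar K).comp_continuous hc).mul hfin.1
  · have h2 : HasCompactSupport Φfin := hfin.2
    have h3 := h2.mul_left (f := fun b => (finiteAdeleAddChar K (∑ i, piFinite K ι y i * b i) : ℂ))
    exact h3
  · funext v
    dsimp only
    have hsplit := adeleAddChar_sum_mul_piAdeleSplit K y ((piAdeleSplit K ι).symm v)
    rw [ContinuousAddEquiv.apply_symm_apply] at hsplit
    simp only [piAdeleSplit_symm_apply] at hsplit
    rw [hsplit, SchwartzMap.smulLeftCLM_apply_apply (hasTemperateGrowth_archLinChar (piArch K ι y)),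
      smul_eq_mul, archLinChar_apply]
    ring

/-- **`𝒮(𝔸_K^ι)` is translation invariant**: `v ↦ Φ(x + v)` lies in `𝒮` for `Φ ∈ 𝒮`. [folklore] -/
theorem comp_add_left_mem_piSchwartzBruhat {Φ : (ι → AdeleRing (𝓞 K) K) → ℂ}
    (hΦ : Φ ∈ piSchwartzBruhat K ι) (x : ι → AdeleRing (𝓞 K) K) :
    (fun v => Φ (x + v)) ∈ piSchwartzBruhat K ι := by
  induction hΦ using Submodule.span_induction with
  | mem Φ h => exact mem_piSchwartzBruhat (h.comp_add_left x)
  | zero => exact (piSchwartzBruhat K ι).zero_mem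
  | add Φ Ψ _ _ ihΦ ihΨ => exact (piSchwartzBruhat K ι).add_mem ihΦ ihΨ
  | smul a Φ _ ih => exact (piSchwartzBruhat K ι).smul_mem a ih

/-- **`𝒮(𝔸_K^ι)` is stable under `v ↦ -v`.** [folklore] -/
theorem comp_neg_mem_piSchwartzBruhat {Φ : (ι → AdeleRing (𝓞 K) K) → ℂ}
    (hΦ : Φ ∈ piSchwartzBruhat K ι) : (fun v => Φ (-v)) ∈ piSchwartzBruhat K ι := by
  induction hΦ using Submodule.span_induction with
  | mem Φ h => exact mem_piSchwartzBruhat h.comp_neg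
  | zero => exact (piSchwartzBruhat K ι).zero_mem
  | add Φ Ψ _ _ ihΦ ihΨ => exact (piSchwartzBruhat K ι).add_mem ihΦ ihΨ
  | smul a Φ _ ih => exact (piSchwartzBruhat K ι).smul_mem a ih

/-- **`𝒮(𝔸_K^ι)` is stable under the character twists** `Φ ↦ ψ(Σ_i y_i v_i) Φ`, `y ∈ 𝔸_K^ι`. [folklore] -/
theorem adeleAddChar_mul_mem_piSchwartzBruhat {Φ : (ι → AdeleRing (𝓞 K) K) → ℂ}
    (hΦ : Φ ∈ piSchwartzBruhat K ι) (y : ι → AdeleRing (𝓞 K) K) :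
    (fun v => (adeleAddChar K (∑ i, y i * v i) : ℂ) * Φ v) ∈ piSchwartzBruhat K ι := by
  induction hΦ using Submodule.span_induction with
  | mem Φ h => exact mem_piSchwartzBruhat (h.adeleAddChar_mul y)
  | zero =>
    have : (fun v : ι → AdeleRing (𝓞 K) K =>
        (adeleAddChar K (∑ i, y i * v i) : ℂ) * (0 : (ι → AdeleRing (𝓞 K) K) → ℂ) v) = 0 :=
      funext fun v => mul_zero _
    rw [this]
    exact (piSchwartzBruhat K ι).zero_mem
  | add Φ Ψ _ _ ihΦ ihΨ =>
    have : (fun v : ι → AdeleRing (𝓞 K) K => (adeleAddChar K (∑ i, y i * v i) : ℂ) * (Φ + Ψ) v) =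
        (fun v => (adeleAddChar K (∑ i, y i * v i) : ℂ) * Φ v) +
          fun v => (adeleAddChar K (∑ i, y i * v i) : ℂ) * Ψ v :=
      funext fun v => mul_add _ _ _
    rw [this]
    exact (piSchwartzBruhat K ι).add_mem ihΦ ihΨ
  | smul a Φ _ ih =>
    have : (fun v : ι → AdeleRing (𝓞 K) K => (adeleAddChar K (∑ i, y i * v i) : ℂ) * (a • Φ) v) =
        a • fun v => (adeleAddChar K (∑ i, y i * v i) : ℂ) * Φ v :=
      funext fun v => by simp only [Pi.smul_apply, smul_eq_mul]; ring
    rw [this]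
    exact (piSchwartzBruhat K ι).smul_mem a ih

end Stability

/-! ### The transform of a twisted translate; orthogonality; unfolding -/

section Identities

attribute [local instance] secondCountableTopology_adeleRing locallyCompactSpace_adeleRing'

variable {K : Type} [Field K] [NumberField K] {ι : Type} [Fintype ι]
  [MeasurableSpace (AdeleRing (𝓞 K) K)] [BorelSpace (AdeleRing (𝓞 K) K)]
  (ν : Measure (ι → AdeleRing (𝓞 K) K)) [ν.IsAddHaarMeasure]

/-- **The transform of a twisted translate**: for `G(v) = ψ(Σ_i y_i v_i) Φ(x + v)`,
`Ĝ(η) = Φ̂(y + η) · ψ(-Σ_i (y_i + η_i) x_i)` (translation invariance of `ν` and `ψ(a)ψ(b) = ψ(a + b)`; no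
hypothesis on `Φ`). [folklore] -/
theorem adelicPiFourier_addChar_mul_comp_add (Φ : (ι → AdeleRing (𝓞 K) K) → ℂ)
    (x y η : ι → AdeleRing (𝓞 K) K) :
    adelicPiFourier K ι ν (fun v => (adeleAddChar K (∑ i, y i * v i) : ℂ) * Φ (x + v)) η =
      adelicPiFourier K ι ν Φ (y + η) * (adeleAddChar K (-(∑ i, (y i + η i) * x i)) : ℂ) := by
  haveI : BorelSpace (ι → AdeleRing (𝓞 K) K) := Pi.borelSpace
  simp only [adelicPiFourier_apply, Pi.add_apply]
  rw [← integral_mul_const]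
  conv_rhs => rw [← integral_add_left_eq_self _ x]
  refine integral_congr_ae (ae_of_all _ fun v => ?_)
  dsimp only
  have hsum : ∑ i, (y i + η i) * (x + v) i =
      (∑ i, (y i + η i) * x i) + ((∑ i, y i * v i) + ∑ i, η i * v i) := by
    rw [← Finset.sum_add_distrib, ← Finset.sum_add_distrib]
    exact Finset.sum_congr rfl fun i _ => by rw [Pi.add_apply]; ring
  have hcancel : (adeleAddChar K (∑ i, (y i + η i) * x i) : ℂ) *
      (adeleAddChar K (-(∑ i, (y i + η i) * x i)) : ℂ) = 1 := by
    rw [← Circle.coe_mul, ← AddChar.map_add_eq_mul, add_neg_cancel, AddChar.map_zero_eq_one,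
      Circle.coe_one]
  rw [hsum, AddChar.map_add_eq_mul, AddChar.map_add_eq_mul, Circle.coe_mul, Circle.coe_mul]
  linear_combination (-(Φ (x + v) * (adeleAddChar K (∑ i, y i * v i) : ℂ) *
    (adeleAddChar K (∑ i, η i * v i) : ℂ))) * hcancel

/-- `∑' ‖f a‖ₑ < ∞` for a norm-summable family. [folklore] -/
theorem tsum_enorm_ne_top_of_summable_norm {α : Type*} {f : α → ℂ} (hf : Summable fun a => ‖f a‖) :
    ∑' a, ‖f a‖ₑ ≠ ∞ := by
  have hs : Summable fun a => ‖f a‖₊ := NNReal.summable_coe.1 (by simpa only [coe_nnnorm] using hf)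
  simp_rw [enorm_eq_nnnorm]
  exact ENNReal.tsum_coe_ne_top_iff_summable.2 hs

/-- **Orthogonality of the characters `y ↦ ψ(Σ_i ξ_i y_i)`, `ξ ∈ K^ι`, on the Tate domain**:
`∫_{D^ι} ψ(Σ_i ξ_i y_i) dν(y) = ν(D^ι)` for `ξ = 0` and `= 0` for `ξ ≠ 0` — these are the characters of
the compact quotient `𝔸_K^ι ⧸ K^ι` (`piQuotChar`), distinct for distinct `ξ` (`piQuotCharHom_injective`),
integrated over the quotient by Tate's Lemma 4.2.1 (`integral_fundamentalDomain_comp_mk`).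
[cite: CasselsFrohlichANT1967, Ch. XV (Tate), Lemma 4.2.1 and Thm. 4.1.4] -/
theorem setIntegral_adeleAddChar_piFundamentalDomain [DecidableEq (ι → K)] (ξ : ι → K) :
    ∫ y in piFundamentalDomain K ι,
        (adeleAddChar K (∑ i, algebraMap K (AdeleRing (𝓞 K) K) (ξ i) * y i) : ℂ) ∂ν =
      if ξ = 0 then ((ν (piFundamentalDomain K ι)).toReal : ℂ) else 0 := by
  haveI := t2Space_adeleRing K
  haveI : Countable K := NumberField.countable' (K := K)
  haveI : BorelSpace (ι → AdeleRing (𝓞 K) K) := Pi.borelSpace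
  letI : MeasurableSpace ((ι → AdeleRing (𝓞 K) K) ⧸ piPrincipalSubgroup K ι) := borel _
  haveI : BorelSpace ((ι → AdeleRing (𝓞 K) K) ⧸ piPrincipalSubgroup K ι) := ⟨rfl⟩
  have hfin : ν (piFundamentalDomain K ι) ≠ ⊤ :=
    ((measure_mono subset_closure).trans_lt
      (isCompact_closure_piFundamentalDomain K ι).measure_lt_top).ne
  have h := Literature.Analysis.Fourier.integral_fundamentalDomain_comp_mk ν
    (isClosed_piPrincipalSubgroup K ι) (isAddFundamentalDomain_op_piFundamentalDomain K ι ν) hfin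
    (G := fun u => (piQuotChar K ξ u : ℂ)) (continuous_piQuotChar K ξ).aestronglyMeasurable
  simp only [piQuotChar_mk, piPairing_apply] at h
  rw [h]
  split_ifs with hξ
  · subst hξ
    have h0 : piQuotChar K (0 : ι → K) = 0 := by rw [← piQuotCharHom_apply, map_zero]
    haveI : IsProbabilityMeasure (addHaarMeasure ⊤ :
        Measure ((ι → AdeleRing (𝓞 K) K) ⧸ piPrincipalSubgroup K ι)) :=
      ⟨by rw [← TopologicalSpace.PositiveCompacts.coe_top]; exact addHaarMeasure_self⟩
    simp only [h0, AddChar.zero_apply, Circle.coe_one, integral_const, probReal_univ, one_smul]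
    rw [Complex.real_smul, mul_one]
  · obtain ⟨a, ha⟩ : ∃ a, piQuotChar K ξ a ≠ 1 := by
      by_contra hall
      push Not at hall
      refine hξ (piQuotCharHom_injective K ι ?_)
      rw [map_zero, piQuotCharHom_apply]
      exact AddChar.eq_zero_iff.2 hall
    rw [integral_addChar_eq_zero _ (piQuotChar K ξ) ha, smul_zero]

/-- The same orthogonality relation with the factors of the pairing commuted: `∫_{D^ι} ψ(Σ_i y_i ξ_i) dν(y)`.
[folklore] -/
theorem setIntegral_adeleAddChar_piFundamentalDomain' [DecidableEq (ι → K)] (ξ : ι → K) :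
    ∫ y in piFundamentalDomain K ι,
        (adeleAddChar K (∑ i, y i * algebraMap K (AdeleRing (𝓞 K) K) (ξ i)) : ℂ) ∂ν =
      if ξ = 0 then ((ν (piFundamentalDomain K ι)).toReal : ℂ) else 0 := by
  have hcomm : ∀ y : ι → AdeleRing (𝓞 K) K, ∑ i, y i * algebraMap K (AdeleRing (𝓞 K) K) (ξ i) =
      ∑ i, algebraMap K (AdeleRing (𝓞 K) K) (ξ i) * y i :=
    fun y => Finset.sum_congr rfl fun i _ => mul_comm _ _
  simp_rw [hcomm]
  exact setIntegral_adeleAddChar_piFundamentalDomain ν ξ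

/-- **Unfolding `∫_V` over the Tate domain**: for `g` integrable on `V = 𝔸_K^ι`,
`∫_V g dν = ∫_{D^ι} Σ_{ξ ∈ K^ι} g(y + ξ) dν(y)` (`D^ι` is a fundamental domain for `K^ι`; Mathlib's
`IsAddFundamentalDomain.integral_eq_tsum''` and the interchange justified by
`IsAddFundamentalDomain.lintegral_eq_tsum''`). [cite: CasselsFrohlichANT1967, Ch. XV (Tate), Lemma 4.2.3] -/
theorem integral_eq_setIntegral_piFundamentalDomain_tsum {g : (ι → AdeleRing (𝓞 K) K) → ℂ}
    (hg : Integrable g ν) :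
    ∫ η, g η ∂ν = ∫ y in piFundamentalDomain K ι,
      ∑' ξ : ι → K, g (y + fun i => algebraMap K (AdeleRing (𝓞 K) K) (ξ i)) ∂ν := by
  haveI := t2Space_adeleRing K
  haveI : Countable K := NumberField.countable' (K := K)
  haveI : BorelSpace (ι → AdeleRing (𝓞 K) K) := Pi.borelSpace
  have h𝓕 := isAddFundamentalDomain_op_piFundamentalDomain K ι ν
  set e : (ι → K) ≃ (piPrincipalSubgroup K ι).op :=
    (piPrincipalSubgroupEquiv K ι).trans (AddSubgroup.equivOp (piPrincipalSubgroup K ι)) with he_def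
  have he : ∀ (ξ : ι → K) (y : ι → AdeleRing (𝓞 K) K),
      e ξ +ᵥ y = y + fun i => algebraMap K (AdeleRing (𝓞 K) K) (ξ i) := fun ξ y => rfl
  have h1 := h𝓕.integral_eq_tsum'' g hg
  rw [← e.tsum_eq] at h1
  simp_rw [he] at h1
  rw [h1, integral_tsum]
  · exact fun ξ => (hg.1.comp_quasiMeasurePreserving
      (measurePreserving_add_right ν _).quasiMeasurePreserving).restrict
  · have h2 := h𝓕.lintegral_eq_tsum'' (fun v => ‖g v‖ₑ)
    rw [← e.tsum_eq] at h2
    simp_rw [he] at h2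
    rw [← h2]
    exact hg.2.ne

end Identities

/-! ### The inversion formula -/

section Inversion

attribute [local instance] secondCountableTopology_adeleRing locallyCompactSpace_adeleRing'

variable {K : Type} [Field K] [NumberField K] {ι : Type} [Fintype ι]
  [MeasurableSpace (AdeleRing (𝓞 K) K)] [BorelSpace (AdeleRing (𝓞 K) K)]
  (ν : Measure (ι → AdeleRing (𝓞 K) K)) [ν.IsAddHaarMeasure]

/-- **The Fourier inversion formula on `𝒮(𝔸_K^ι)`** (Tate's Theorem 4.1.2 on the Schwartz–Bruhat space, in
unnormalised form): for `Φ ∈ 𝒮(𝔸_K^ι)`, an additive Haar measure `ν` on `𝔸_K^ι` and every `x`,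
`Φ̂̂(x) = ν(D^ι)² Φ(-x)`, where `Φ̂ = adelicPiFourier K ι ν Φ` and `D^ι = piFundamentalDomain K ι` is the Tate
domain — for the self-dual normalisation `ν(D^ι) = 1` this is `Φ̂̂(x) = Φ(-x)`. Proof: Poisson summation for
the twisted translates `ψ(Σ y_i v_i)Φ(x + v)`, integrated over `y ∈ D^ι` (orthogonality on the left,
unfolding on the right), as in Tate's remark after Thm. 4.2.1.
[cite: CasselsFrohlichANT1967, Ch. XV (Tate), Thm. 4.1.2 with Thm. 4.1.3 (2) and the remark after Thm. 4.2.1] -/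
theorem adelicPiFourier_adelicPiFourier {Φ : (ι → AdeleRing (𝓞 K) K) → ℂ}
    (hΦ : Φ ∈ piSchwartzBruhat K ι) (x : ι → AdeleRing (𝓞 K) K) :
    adelicPiFourier K ι ν (adelicPiFourier K ι ν Φ) x =
      (((ν (piFundamentalDomain K ι)).toReal ^ 2 : ℝ) : ℂ) * Φ (-x) := by
  classical
  suffices h : ∀ x' : ι → AdeleRing (𝓞 K) K, adelicPiFourier K ι ν (adelicPiFourier K ι ν Φ) (-x') =
      (((ν (piFundamentalDomain K ι)).toReal ^ 2 : ℝ) : ℂ) * Φ x' by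
    have := h (-x); rwa [neg_neg] at this
  intro x
  haveI := t2Space_adeleRing K
  haveI : Countable K := NumberField.countable' (K := K)
  haveI : BorelSpace (ι → AdeleRing (𝓞 K) K) := Pi.borelSpace
  set c : ℝ := (ν (piFundamentalDomain K ι)).toReal with hc_def
  have hc0 : c ≠ 0 := (Weil1964.measure_piFundamentalDomain_toReal_pos (ν := ν)).ne'
  have hfin : ν (piFundamentalDomain K ι) ≠ ⊤ :=
    ((measure_mono subset_closure).trans_lt
      (isCompact_closure_piFundamentalDomain K ι).measure_lt_top).ne
  -- the function `g(η) = Φ̂(η) ψ(-Σ η_i x_i)`, integrable with `∫ g = Φ̂̂(-x)`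
  have hΦhat : adelicPiFourier K ι ν Φ ∈ piSchwartzBruhat K ι := adelicPiFourier_mem_piSchwartzBruhat hΦ
  have hψc : Continuous fun η : ι → AdeleRing (𝓞 K) K => (adeleAddChar K (-(∑ i, η i * x i)) : ℂ) :=
    continuous_subtype_val.comp ((continuous_adeleAddChar K).comp
      (continuous_finsetSum _ fun i _ => (continuous_apply i).mul continuous_const).neg)
  have hg : Integrable (fun η : ι → AdeleRing (𝓞 K) K =>
      adelicPiFourier K ι ν Φ η * (adeleAddChar K (-(∑ i, η i * x i)) : ℂ)) ν :=
    (integrable_of_mem_piSchwartzBruhat hΦhat).mul_bdd hψc.aestronglyMeasurable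
      (ae_of_all _ fun η => (Circle.norm_coe _).le)
  have hgint : ∫ η, adelicPiFourier K ι ν Φ η * (adeleAddChar K (-(∑ i, η i * x i)) : ℂ) ∂ν =
      adelicPiFourier K ι ν (adelicPiFourier K ι ν Φ) (-x) := by
    rw [adelicPiFourier_apply]
    refine integral_congr_ae (ae_of_all _ fun η => ?_)
    dsimp only
    have : ∑ i, (-x) i * η i = -(∑ i, η i * x i) := by
      rw [← Finset.sum_neg_distrib]
      exact Finset.sum_congr rfl fun i _ => by rw [Pi.neg_apply, neg_mul, mul_comm]
    rw [this]
  -- Step 1: Poisson summation for the twisted translates `ψ(Σ y_i v_i) Φ(x + v)`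
  have hP : ∀ y : ι → AdeleRing (𝓞 K) K,
      ∑' ξ : ι → K, (adeleAddChar K (∑ i, y i * algebraMap K (AdeleRing (𝓞 K) K) (ξ i)) : ℂ) *
          Φ (x + fun i => algebraMap K (AdeleRing (𝓞 K) K) (ξ i)) =
        ((c⁻¹ : ℝ) : ℂ) * ∑' ξ : ι → K,
          adelicPiFourier K ι ν Φ (y + fun i => algebraMap K (AdeleRing (𝓞 K) K) (ξ i)) *
            (adeleAddChar K (-(∑ i, (y + fun i => algebraMap K (AdeleRing (𝓞 K) K) (ξ i)) i * x i)) : ℂ) := by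
    intro y
    have hG : (fun v => (adeleAddChar K (∑ i, y i * v i) : ℂ) * Φ (x + v)) ∈ piSchwartzBruhat K ι :=
      adeleAddChar_mul_mem_piSchwartzBruhat (comp_add_left_mem_piSchwartzBruhat hΦ x) y
    rw [tsum_eq_inv_measure_mul_tsum_adelicPiFourier (ν := ν) hG]
    congr 1
    exact tsum_congr fun ξ => adelicPiFourier_addChar_mul_comp_add ν Φ x y _
  -- Step 2: integrate over `y ∈ D^ι`; the left side by orthogonality
  have hL : ∫ y in piFundamentalDomain K ι, ∑' ξ : ι → K,
      (adeleAddChar K (∑ i, y i * algebraMap K (AdeleRing (𝓞 K) K) (ξ i)) : ℂ) *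
        Φ (x + fun i => algebraMap K (AdeleRing (𝓞 K) K) (ξ i)) ∂ν = (c : ℂ) * Φ x := by
    have h1 : ∀ ξ : ι → K, AEStronglyMeasurable (fun y : ι → AdeleRing (𝓞 K) K =>
        (adeleAddChar K (∑ i, y i * algebraMap K (AdeleRing (𝓞 K) K) (ξ i)) : ℂ) *
          Φ (x + fun i => algebraMap K (AdeleRing (𝓞 K) K) (ξ i)))
        (ν.restrict (piFundamentalDomain K ι)) := fun ξ =>
      ((continuous_subtype_val.comp ((continuous_adeleAddChar K).comp
        (continuous_finsetSum _ fun i _ => (continuous_apply i).mul continuous_const))).mul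
          continuous_const).aestronglyMeasurable
    have hsum : Summable fun ξ : ι → K =>
        ‖Φ (x + fun i => algebraMap K (AdeleRing (𝓞 K) K) (ξ i))‖ := by
      simpa only using summable_norm_of_mem_piSchwartzBruhat (comp_add_left_mem_piSchwartzBruhat hΦ x)
    have h2 : ∑' ξ : ι → K, ∫⁻ y in piFundamentalDomain K ι,
        ‖(adeleAddChar K (∑ i, y i * algebraMap K (AdeleRing (𝓞 K) K) (ξ i)) : ℂ) *
          Φ (x + fun i => algebraMap K (AdeleRing (𝓞 K) K) (ξ i))‖ₑ ∂ν ≠ ∞ := by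
      have hpt : ∀ (ξ : ι → K) (y : ι → AdeleRing (𝓞 K) K),
          ‖(adeleAddChar K (∑ i, y i * algebraMap K (AdeleRing (𝓞 K) K) (ξ i)) : ℂ) *
            Φ (x + fun i => algebraMap K (AdeleRing (𝓞 K) K) (ξ i))‖ₑ =
            ‖Φ (x + fun i => algebraMap K (AdeleRing (𝓞 K) K) (ξ i))‖ₑ := by
        intro ξ y
        rw [enorm_mul, ← ofReal_norm ((adeleAddChar K _ : Circle) : ℂ), Circle.norm_coe,
          ENNReal.ofReal_one, one_mul]
      simp_rw [hpt, setLIntegral_const, ENNReal.tsum_mul_right]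
      exact ENNReal.mul_ne_top (tsum_enorm_ne_top_of_summable_norm hsum) hfin
    rw [integral_tsum h1 h2]
    simp_rw [integral_mul_const, setIntegral_adeleAddChar_piFundamentalDomain' ν, ite_mul, zero_mul]
    rw [tsum_eq_single (0 : ι → K) (fun ξ hξ => if_neg hξ), if_pos rfl]
    have h0 : (fun i => algebraMap K (AdeleRing (𝓞 K) K) ((0 : ι → K) i)) = 0 :=
      funext fun i => by rw [Pi.zero_apply, map_zero, Pi.zero_apply]
    rw [h0, add_zero, hc_def]
  -- the right side by unfolding
  have hR : ∫ y in piFundamentalDomain K ι, ((c⁻¹ : ℝ) : ℂ) * ∑' ξ : ι → K,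
      adelicPiFourier K ι ν Φ (y + fun i => algebraMap K (AdeleRing (𝓞 K) K) (ξ i)) *
        (adeleAddChar K (-(∑ i, (y + fun i => algebraMap K (AdeleRing (𝓞 K) K) (ξ i)) i * x i)) : ℂ) ∂ν =
      ((c⁻¹ : ℝ) : ℂ) * adelicPiFourier K ι ν (adelicPiFourier K ι ν Φ) (-x) := by
    rw [integral_const_mul, ← integral_eq_setIntegral_piFundamentalDomain_tsum ν hg, hgint]
  -- Step 3: compare
  have hI := congrArg (fun F : (ι → AdeleRing (𝓞 K) K) → ℂ => ∫ y in piFundamentalDomain K ι, F y ∂ν)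
    (funext hP)
  rw [hL, hR, Complex.ofReal_inv] at hI
  have hc' : (c : ℂ) ≠ 0 := Complex.ofReal_ne_zero.2 hc0
  calc adelicPiFourier K ι ν (adelicPiFourier K ι ν Φ) (-x)
      = (c : ℂ) * ((c : ℂ)⁻¹ * adelicPiFourier K ι ν (adelicPiFourier K ι ν Φ) (-x)) := by
        rw [← mul_assoc, mul_inv_cancel₀ hc', one_mul]
    _ = (c : ℂ) * ((c : ℂ) * Φ x) := by rw [← hI]
    _ = ((c ^ 2 : ℝ) : ℂ) * Φ x := by push_cast; ring

/-- The inversion formula as an identity of functions: `Φ̂̂ = ν(D^ι)² · Φ(-·)`. [folklore] -/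
theorem adelicPiFourier_adelicPiFourier_eq {Φ : (ι → AdeleRing (𝓞 K) K) → ℂ}
    (hΦ : Φ ∈ piSchwartzBruhat K ι) :
    adelicPiFourier K ι ν (adelicPiFourier K ι ν Φ) =
      fun x => (((ν (piFundamentalDomain K ι)).toReal ^ 2 : ℝ) : ℂ) * Φ (-x) :=
  funext fun x => adelicPiFourier_adelicPiFourier ν hΦ x

/-- **Fourier inversion for the self-dual normalisation**: if `ν(D^ι) = 1` then `Φ̂̂(x) = Φ(-x)` for
`Φ ∈ 𝒮(𝔸_K^ι)` (Tate's Theorem 4.1.2 for the measure of Thm. 4.1.3 (2)).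
[cite: CasselsFrohlichANT1967, Ch. XV (Tate), Thm. 4.1.2] -/
theorem adelicPiFourier_adelicPiFourier_of_measure_eq_one {Φ : (ι → AdeleRing (𝓞 K) K) → ℂ}
    (hΦ : Φ ∈ piSchwartzBruhat K ι) (hν : ν (piFundamentalDomain K ι) = 1)
    (x : ι → AdeleRing (𝓞 K) K) :
    adelicPiFourier K ι ν (adelicPiFourier K ι ν Φ) x = Φ (-x) := by
  rw [adelicPiFourier_adelicPiFourier ν hΦ, hν, ENNReal.toReal_one, one_pow, Complex.ofReal_one,
    one_mul]

/-- **The transform is injective on `𝒮(𝔸_K^ι)`.** [folklore] -/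
theorem eq_of_adelicPiFourier_eq {Φ Ψ : (ι → AdeleRing (𝓞 K) K) → ℂ}
    (hΦ : Φ ∈ piSchwartzBruhat K ι) (hΨ : Ψ ∈ piSchwartzBruhat K ι)
    (h : adelicPiFourier K ι ν Φ = adelicPiFourier K ι ν Ψ) : Φ = Ψ := by
  funext x
  have hx := congrArg (fun F => adelicPiFourier K ι ν F (-x)) h
  rw [adelicPiFourier_adelicPiFourier ν hΦ, adelicPiFourier_adelicPiFourier ν hΨ, neg_neg] at hx
  have hc : (((ν (piFundamentalDomain K ι)).toReal ^ 2 : ℝ) : ℂ) ≠ 0 :=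
    Complex.ofReal_ne_zero.2 (pow_ne_zero 2 (Weil1964.measure_piFundamentalDomain_toReal_pos (ν := ν)).ne')
  exact mul_left_cancel₀ hc hx

end Inversion

end Literature.NumberTheory.Automorphic

end
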